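import Summits.QuantumFields.BalabanUV.T4Continuum.Support.NE7K1LinWalkRegion

/-!
# NE7K1LinWalkFineOpRegion — row NE7 (node U5), candidate route HOM, path H1L, cell K1-lin(s): B4 (2.12)–(2.13) ∕ (2.22) AT `A = 0` IN KERNEL
# ON A GENERAL REGION — THE RANDOM-WALK EXPANSION OF `G_k(Ω,0) = (−Δ^{η,N}_Ω + aQ_k*Q_k)⁻¹` FOR `Ω` ANY UNION OF BIG BLOCKS CONVERGES FOR
# `M ≥ M₀(d,a)`, UNIFORMLY IN THE MESH `η = 1∕n` AND IN `Ω`, WITH GEOMETRIC DECAY ACROSS `M`-CUBES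

Lineage `b2b-balaban-t4-ne7-p2` (CRUX PROVER NE7 #2), generation 70; series (RW) file 19 = gen 68's assembly `NE7K1LinWalkFineOp` (file 8,
the ALIGNED BOX) re-run on the regions of `NE7K1LinWalkRegion` (file 18).  [Balaban1983RegularityDecay] = T. Bałaban, Commun. Math. Phys.
89 (1983) 571–597, §1 p. 572 («operators on subsets of the lattice ηZ^d», `G_k(Ω, A)` (1.6), «Ω a union of big blocks») and §2.

THE INSTANCE.  Mesh `1∕n` (`n ≥ 1`), cube scale `M ≥ 3` blocks (`W = M·n` sites = one big block), labels `J ∈ Π_μ{0..K_μ}` (any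
`K ∈ ℕ^{d+1}`), and the region `Ω = reg (Mn) K C = {x ∈ Π_μ[0,(2K_μ+1)Mn) : blk (Mn) x ∈ C}` for an ARBITRARY cell set `C ⊂ ℤ^{d+1}` — by
`NE7K1LinWalkRegion.reg_image_blk_eq` these are EXACTLY the unions of big blocks inside the bounding box (the box itself, L-shapes,
regions with holes, disconnected unions; the bounding box is no restriction since `K` is arbitrary); `a > 0`;
`P = fineOpR n a 0 Ω = n²(−Δ^N_Ω) + (a∕n^{d+1})1_{same n-block}` (B4 (1.6) at `A = 0` with NEUMANN conditions on `∂Ω`, `B4Lower18`); cut-offs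
`l_J = cut (Mn) J|_Ω` (gen 68's product cut-offs, UNMODIFIED), `r_J = 1_{S_J}`, regions `S_J = region Ω (Mn) n J`.
Every hypothesis of `NE7K1LinWalkExpansion.inv_entry_decay` is DISCHARGED on `Ω` (`§2`): coercivity `min(2,a)` (`B4Lower18.lower18_zero`,
`Ω` is a union of `n`-blocks: `reg_isBlockUnion_fine`), cut-offs live on their regions (range `n` of `P`), `Σ_J l_J r_J ≡ 1` on `Ω`
(`sum_cut_eq_one_region`), disjointness of non-adjacent regions (`2n < Mn`), overlap and covering numbers `≤ 3^{d+1}`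
(`B4RandomWalk213.card_cubeAdj_le`), and (H-comm) with the SAME MESH-FREE constants as on the box, `α² = 192(d+1)∕M²`,
`β² = 3(1024(d+1)²∕M⁴ + 16a²(d+1)²∕M²)` — because the Neumann second difference of the unmodified cut-offs is `≤ 32(d+1)∕W²` at every site
of every union of big blocks (`NE7K1LinWalkRegion.abs_sum_nbrs_cut_sub_le_region`: the profile is flat to second order at every cell
face).

* **`hasSum_fineOpR_walk_region`** — for `3^{d+1}·τ < 1`, `τ = NE7K1LinWalkFineOp.tau d M a`: `G_k(Ω,0) = Σ_{k≥0} G₀Rᵏ` converges in the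
  `ℓ²`-operator norm for EVERY region `Ω` — B4 (2.12) AT A = 0 in the printed generality of `Ω`, threshold explicit in `d, a` and free of
  `n`, `Ω`.
* **`fineOpR_inv_entry_decay_region`** — under the same smallness, for sites `x, y ∈ Ω` with `|x_μ − y_μ| ≥ (2N+3)Mn + n` in some
  coordinate (`N ≥ 1`): `|G_k(Ω,0)(x,y)| ≤ 3^{d+1}·σ′⁻¹·τ·3^{d+1}·(3^{d+1}τ)^{N−1}∕(1 − 3^{d+1}τ)` — B4 (2.22)∕(2.30)'s geometric decay at
  A = 0, uniformly in the mesh and in the region, WITHOUT any restriction `dist(x, Ω^c) ≥ R₀` on the points.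
* **`fineOpR_inv_entry_decay_blockUnion`** (§4) — the decay statement for `(fineOpR n a 0 R)⁻¹` with `R ⊆ Π_μ[0,(2K_μ+1)Mn)` ANY union
  of `Mn`-blocks (`IsBlockUnion (Mn) R`), transported along `NE7K1LinWalkRegion.reg_image_blk_eq`.
Gen 68's box theorems are the case `C ⊇` all cells (`NE7K1LinWalkRegion.reg_box`).

HONEST FRAMING: [folklore] assembly; A = 0 only (no background field, no covariant derivative, no gauge group), ONE scale (no multi-scale
factor `M^{−½|ω|}`, no Hölder norms of B4 §3, no `δG` clause); the decay rate is B4's SHAPE with crude explicit constants, not optimised;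
nothing of Bałaban's beyond (1.6)/(1.8)/(2.2)–(2.13) at A = 0 is touched; no `sorry`.  Census: cell K1-lin(s)'s «template application» —
random-walk half — now typed for the s = 0 endpoint `P₀` at U = 1 on EVERY union of big blocks (was: aligned boxes).  NO letter ∕ tag ∕
size of NE7 moves; NE7 NOT PRINTED ∕ NOT PROVED; spine 0∕9; FIXED FINITE T⁴, rung (B)+1; NOT infinite volume, NOT mass gap, NOT Clay.
HONEST DEPENDENCY: continuum YM on T⁴ ⇐ BetaPertH ∧ nine spine estimates (0/9 proved); BetaPertH ⇐ (D1) ∧ (D4) ∧ CAP+tail; G-an2-4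
gates asym, D1 and NE2/3/4.
-/

noncomputable section

open Finset Matrix
open scoped Matrix.Norms.L2Operator

namespace Summit.QuantumFields.BalabanUV.T4Continuum.NE7K1LinWalkFineOpRegion

open NE7K1LinWalkParametrix NE7K1LinWalkSmallness NE7K1LinWalkExpansion NE7K1LinWalkCommutator NE7K1LinWalkProfile
  NE7K1LinWalkCubes NE7K1LinWalkBox NE7K1LinWalkFineOp NE7K1LinWalkRegion
open Literature.MathematicalPhysics.QuantumFieldTheory.Balaban1983to89
open Literature.MathematicalPhysics.QuantumFieldTheory.Balaban1983to89.B4Reflection242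
open Literature.MathematicalPhysics.QuantumFieldTheory.Balaban1983to89.B4BoxCov237
open Literature.MathematicalPhysics.QuantumFieldTheory.Balaban1983to89.B4Lower18

variable {d : ℕ}

/-! ### §1 The data of the instance on a region -/

/-- the smooth cut-offs `l_J = cut (Mn) J` restricted to the region `Ω = reg (Mn) K C`. [cite: Balaban1983RegularityDecay, (2.2) p.575 «h_j», dictionary] [folklore] -/
def cutG (n M : ℕ) (K : Fin (d + 1) → ℕ) (C : Finset (Fin (d + 1) → ℤ)) (J : Lab K) : ↥(reg (M * n) K C) → ℝ :=
  fun x => cut (M * n) J.1 x.1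

/-- the regions `S_J ⊂ Ω` (support cube + range margin `n`, intersected with `Ω`). [cite: Balaban1983RegularityDecay, (2.2) p.575 «□_j», dictionary] [folklore] -/
def regG (n M : ℕ) (K : Fin (d + 1) → ℕ) (C : Finset (Fin (d + 1) → ℤ)) (J : Lab K) : Finset ↥(reg (M * n) K C) :=
  region (reg (M * n) K C) (M * n) n J.1

/-- the indicator cut-offs `r_J = 1_{S_J}`. [folklore] -/
def indG (n M : ℕ) (K : Fin (d + 1) → ℕ) (C : Finset (Fin (d + 1) → ℤ)) (J : Lab K) : ↥(reg (M * n) K C) → ℝ :=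
  fun x => if x ∈ regG n M K C J then 1 else 0

/-! ### §2 The hypotheses of the abstract expansion, discharged on the region -/

section Hyps

variable {n M : ℕ} (hn : 1 ≤ n) (hM : 3 ≤ M) (K : Fin (d + 1) → ℕ) (C : Finset (Fin (d + 1) → ℤ)) {a : ℝ} (ha : 0 < a)

include hn ha in
/-- **COERCIVITY** `min(2,a)` on the region (B4 (1.8) at A = 0 for `G_k(Ω,0)`, `B4Lower18.lower18_zero`; `Ω` is a union of `n`-blocks).
[cite: Balaban1983RegularityDecay, p.573 (1.8) «γ₀ independent of … Ω», case A = 0] [folklore] -/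
theorem fineOpR_coercive_region (M : ℕ) (K : Fin (d + 1) → ℕ) (C : Finset (Fin (d + 1) → ℤ)) (g : ↥(reg (M * n) K C) → ℝ) :
    min 2 a * (g ⬝ᵥ g) ≤ g ⬝ᵥ fineOpR n a 0 (reg (M * n) K C) *ᵥ g :=
  lower18_zero hn ha.le (reg_isBlockUnion_fine hn M K C) g

include hn in
/-- **THE CUT-OFFS LIVE ON THEIR REGIONS** (both clauses of `CutoffOn`, from the range `n` of `fineOpR` on `Ω`). [folklore] -/
theorem cutoffOn_cutG (hW : 1 ≤ M * n) (J : Lab K) : CutoffOn (fineOpR n a 0 (reg (M * n) K C)) (cutG n M K C J) (regG n M K C J) := by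
  refine ⟨fun x hx => mem_region_self_of_cut_ne_zero hW hx, fun x y hx hy => ?_⟩
  constructor
  · by_contra h
    exact hy (mem_region_of_cut_ne_zero hW hx fun μ => fineOpR_ne_zero_close hn h μ)
  · by_contra h
    exact hy (mem_region_of_cut_ne_zero hW hx fun μ => by rw [abs_sub_comm]; exact fineOpR_ne_zero_close hn h μ)

/-- `l_J · r_J = l_J` pointwise. [folklore] -/
theorem cutG_mul_indG (hW : 1 ≤ M * n) (J : Lab K) (x : ↥(reg (M * n) K C)) :
    cutG n M K C J x * indG n M K C J x = cutG n M K C J x := by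
  by_cases h : cutG n M K C J x = 0
  · rw [h, zero_mul]
  · have hx : x ∈ regG n M K C J := mem_region_self_of_cut_ne_zero hW h
    simp only [indG, if_pos hx, mul_one]

/-- **PARTITION OF UNITY** `Σ_J l_J r_J ≡ 1` on the region. [folklore] -/
theorem sum_cutG_mul_indG (hW : 1 ≤ M * n) (x : ↥(reg (M * n) K C)) : ∑ J : Lab K, cutG n M K C J x * indG n M K C J x = 1 := by
  simp_rw [cutG_mul_indG K C hW]
  have e : ∑ J : Lab K, cutG n M K C J x = ∑ J ∈ labs K, cut (M * n) J x.1 :=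
    Finset.sum_coe_sort (labs K) (fun J' => cut (M * n) J' x.1)
  rw [e]
  exact sum_cut_eq_one_region hW K C x.2

/-- `|l_J| ≤ 1`, `|r_J| ≤ 1`, `r_J ≠ 0 ⇒` in the region. [folklore] -/
theorem cutG_indG_bounds (J : Lab K) (x : ↥(reg (M * n) K C)) :
    |cutG n M K C J x| ≤ 1 ∧ |indG n M K C J x| ≤ 1 ∧ (indG n M K C J x ≠ 0 → x ∈ regG n M K C J) := by
  refine ⟨abs_cut_le_one _ _ _, ?_, ?_⟩
  · unfold indG; split_ifs <;> simp
  · unfold indG; split_ifs with h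
    · exact fun _ => h
    · simp

/-- **DISJOINTNESS** of non-adjacent regions (`2n < Mn`). [folklore] -/
theorem disjoint_regG (hρ : 2 * n < M * n) {J J' : Lab K} (h : ¬ B4RandomWalk213.cubeAdj (labPos K) J J') :
    Disjoint (regG n M K C J) (regG n M K C J') :=
  disjoint_region hρ h

/-- **OVERLAP NUMBER `≤ 3^{d+1}`**: a region meets at most `3^{d+1}` regions (`B4RandomWalk213.card_cubeAdj_le`). [folklore] -/
theorem count_overlap_le_region (hρ : 2 * n < M * n) (J : Lab K) :
    (univ.filter fun J' : Lab K => ¬ Disjoint (regG n M K C J) (regG n M K C J')).card ≤ 3 ^ (d + 1) := by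
  classical
  have hadj := B4RandomWalk213.card_cubeAdj_le (labPos K) (labPos_injective K)
  refine le_trans (Finset.card_le_card fun J' hJ' => ?_) (hadj J)
  rw [Finset.mem_filter] at hJ' ⊢
  refine ⟨Finset.mem_univ _, ?_⟩
  obtain ⟨y, hy, hy'⟩ := Finset.not_disjoint_iff.mp hJ'.2
  exact labelAdj_of_mem_region hρ hy hy'

/-- **COVERING NUMBERS `≤ 3^{d+1}`**: at most `3^{d+1}` regions (resp. cut-off supports) contain a given site. [folklore] -/
theorem count_cover_le_region (hρ : 2 * n < M * n) (x : ↥(reg (M * n) K C)) :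
    (univ.filter fun J' : Lab K => indG n M K C J' x ≠ 0).card ≤ 3 ^ (d + 1) ∧
      (univ.filter fun J' : Lab K => cutG n M K C J' x ≠ 0).card ≤ 3 ^ (d + 1) := by
  classical
  have hadj := B4RandomWalk213.card_cubeAdj_le (labPos K) (labPos_injective K)
  have hW : 1 ≤ M * n := by omega
  refine ⟨?_, ?_⟩
  · by_cases hne : (univ.filter fun J' : Lab K => indG n M K C J' x ≠ 0).Nonempty
    · obtain ⟨J₀, hJ₀⟩ := hne
      have hx₀ : x ∈ regG n M K C J₀ := ((cutG_indG_bounds K C J₀ x).2.2) (Finset.mem_filter.mp hJ₀).2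
      refine le_trans (Finset.card_le_card fun J' hJ' => ?_) (hadj J₀)
      rw [Finset.mem_filter] at hJ' ⊢
      exact ⟨Finset.mem_univ _, labelAdj_of_mem_region hρ hx₀ (((cutG_indG_bounds K C J' x).2.2) hJ'.2)⟩
    · rw [Finset.not_nonempty_iff_eq_empty.mp hne, Finset.card_empty]; positivity
  · by_cases hne : (univ.filter fun J' : Lab K => cutG n M K C J' x ≠ 0).Nonempty
    · obtain ⟨J₀, hJ₀⟩ := hne
      have hx₀ : x ∈ regG n M K C J₀ := mem_region_self_of_cut_ne_zero hW (Finset.mem_filter.mp hJ₀).2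
      refine le_trans (Finset.card_le_card fun J' hJ' => ?_) (hadj J₀)
      rw [Finset.mem_filter] at hJ' ⊢
      exact ⟨Finset.mem_univ _, labelAdj_of_mem_region hρ hx₀ (mem_region_self_of_cut_ne_zero hW hJ'.2)⟩
    · rw [Finset.not_nonempty_iff_eq_empty.mp hne, Finset.card_empty]; positivity

include hn ha in
/-- **(H-comm) ON THE REGION WITH THE BOX'S MESH-FREE CONSTANTS**: `‖[diag(l_J), P]v‖² ≤ α²⟨v,Pv⟩ + β²‖v‖²`, `α² = 192(d+1)∕M²`,
`β² = 3(1024(d+1)²∕M⁴ + 16a²(d+1)²∕M²)` — the Neumann second difference of the unmodified cut-offs is `≤ 32(d+1)∕W²` on every union of big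
blocks (`NE7K1LinWalkRegion.abs_sum_nbrs_cut_sub_le_region`). [cite: Balaban1983RegularityDecay, (2.3) p.575 + Lemma 2.1 (2.15) p.577, case A = 0] [folklore] -/
theorem hcomm_cutG (hW2 : 2 ≤ M * n) (J : Lab K) (v : ↥(reg (M * n) K C) → ℝ) :
    comm (cutG n M K C J) (fineOpR n a 0 (reg (M * n) K C)) *ᵥ v ⬝ᵥ comm (cutG n M K C J) (fineOpR n a 0 (reg (M * n) K C)) *ᵥ v ≤
      alpha2 d M * (v ⬝ᵥ fineOpR n a 0 (reg (M * n) K C) *ᵥ v) + beta2 d M a * (v ⬝ᵥ v) := by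
  have hW : 1 ≤ M * n := le_trans (by norm_num) hW2
  have hn0 : (0 : ℝ) < n := by exact_mod_cast hn
  have hM0 : (0 : ℝ) < M := by
    have : 1 ≤ M := by nlinarith
    exact_mod_cast this
  have hWr : ((M * n : ℕ) : ℝ) = (M : ℝ) * n := by push_cast; ring
  have h := comm_mulVec_sq_le_fineOpR hn (reg_isBlockUnion_fine hn M K C) ha.le (cutG n M K C J)
    (ℓ₁ := 4 / ((M * n : ℕ) : ℝ)) (ℓ₂ := 32 * ((d : ℝ) + 1) / ((M * n : ℕ) : ℝ) ^ 2) (ℓ₃ := 4 * ((d : ℝ) + 1) * n / ((M * n : ℕ) : ℝ))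
    (by positivity) (by positivity)
    (fun x y hxy => abs_cut_sub_cut_of_mem_nbrs hW J.1 hxy)
    (fun x => abs_sum_nbrs_cut_sub_le_region hW2 K C J.1 x)
    (fun x y hxy => abs_cut_sub_cut_of_blk_eq hW hn J.1 hxy) v
  have hform : 0 ≤ v ⬝ᵥ fineOpR n a 0 (reg (M * n) K C) *ᵥ v :=
    le_trans (mul_nonneg (le_min zero_le_two ha.le) (Finset.sum_nonneg fun i _ => mul_self_nonneg _))
      (fineOpR_coercive_region hn ha M K C v)
  have hvv : 0 ≤ v ⬝ᵥ v := Finset.sum_nonneg fun i _ => mul_self_nonneg _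
  refine h.trans (le_of_eq ?_)
  simp only [alpha2, beta2, hWr]
  field_simp
  ring

end Hyps

/-! ### §3 B4 (2.12)–(2.13) and (2.22) at A = 0 on a general region -/

/-- the remainder is small: `‖R‖ ≤ 3^{d+1}·τ` on every region. [cite: Balaban1983RegularityDecay, p.577 after (2.12), case A = 0] [folklore] -/
theorem l2_opNorm_remainder_region {n M : ℕ} (hn : 1 ≤ n) (hM : 3 ≤ M) (K : Fin (d + 1) → ℕ) (C : Finset (Fin (d + 1) → ℤ))
    {a : ℝ} (ha : 0 < a) :
    ‖∑ J : Lab K, bPiece (fineOpR n a 0 (reg (M * n) K C)) (cutG n M K C J) (indG n M K C J) (regG n M K C J)‖ ≤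
      (3 : ℝ) ^ (d + 1) * tau d M a := by
  classical
  obtain ⟨hW, hW2, hρ⟩ := scale_facts hn hM
  have hσ : 0 < min 2 a := lt_min two_pos ha
  have hα : 0 ≤ alpha2 d M := by unfold alpha2; positivity
  have hβ : 0 ≤ beta2 d M a := by unfold beta2; positivity
  have h := l2_opNorm_remainder_le (fineOpR n a 0 (reg (M * n) K C)) hσ (fineOpR_coercive_region hn ha M K C)
    (cutG n M K C) (indG n M K C) (regG n M K C) (cutoffOn_cutG hn K C hW) (fun J x => (cutG_indG_bounds K C J x).2.2)
    (fun J x => (cutG_indG_bounds K C J x).2.1) hα hβ (hcomm_cutG hn K C ha hW2)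
    (fun J => count_overlap_le_region K C hρ J) (fun x => (count_cover_le_region K C hρ x).1)
  refine h.trans (le_of_eq ?_)
  rw [tau, ← Real.sqrt_sq (by positivity : (0 : ℝ) ≤ (3 : ℝ) ^ (d + 1)), ← Real.sqrt_mul (by positivity)]
  congr 1; push_cast; ring

/-- **B4 (2.12)–(2.13) AT `A = 0` ON A GENERAL REGION, CONVERGENT**: for `3^{d+1}·τ < 1` the random-walk expansion of
`G_k(Ω,0) = (fineOpR n a 0 Ω)⁻¹` over the `M`-cubes converges in the `ℓ²`-operator norm, `HasSum (k ↦ G₀Rᵏ) G_k(Ω,0)`, for EVERY region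
`Ω = reg (Mn) K C` (every union of big blocks in the bounding box) — uniformly in the mesh `1∕n` and in `Ω` (the threshold depends on `d`
and `a` only). [cite: Balaban1983RegularityDecay, (2.12)–(2.13) p.577, case A = 0] [folklore] -/
theorem hasSum_fineOpR_walk_region {n M : ℕ} (hn : 1 ≤ n) (hM : 3 ≤ M) (K : Fin (d + 1) → ℕ) (C : Finset (Fin (d + 1) → ℤ)) {a : ℝ}
    (ha : 0 < a) (hsmall : (3 : ℝ) ^ (d + 1) * tau d M a < 1) :
    HasSum (fun k : ℕ => (∑ J : Lab K, aPiece (fineOpR n a 0 (reg (M * n) K C)) (cutG n M K C J) (indG n M K C J) (regG n M K C J)) *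
        (∑ J : Lab K, bPiece (fineOpR n a 0 (reg (M * n) K C)) (cutG n M K C J) (indG n M K C J) (regG n M K C J)) ^ k)
      (fineOpR n a 0 (reg (M * n) K C))⁻¹ := by
  obtain ⟨hW, -, -⟩ := scale_facts hn hM
  exact hasSum_walk_expansion _ (lt_min two_pos ha) (fineOpR_coercive_region hn ha M K C) _ _ _ (cutoffOn_cutG hn K C hW)
    (sum_cutG_mul_indG K C hW) ((l2_opNorm_remainder_region hn hM K C ha).trans_lt hsmall)

/-- **B4 (2.22)∕(2.30) AT `A = 0` ON A GENERAL REGION — GEOMETRIC DECAY OF `G_k(Ω,0)` ACROSS `M`-CUBES, UNIFORMLY IN THE MESH AND IN THE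
REGION**: for `3^{d+1}τ < 1` and sites `x, y` of `Ω = reg (Mn) K C` with `|x_μ − y_μ| ≥ (2N+3)Mn + n` in some coordinate (`N ≥ 1`),
`|G_k(Ω,0)(x,y)| ≤ 3^{d+1}·(min(min(2,a),1))⁻¹·τ·3^{d+1}·(3^{d+1}τ)^{N−1}∕(1 − 3^{d+1}τ)` — no restriction `dist(x, Ω^c) ≥ R₀`.
[cite: Balaban1983RegularityDecay, (2.22) p.579, Corollary 2.3 (2.30) pp.580–581, case A = 0] [folklore] -/
theorem fineOpR_inv_entry_decay_region {n M : ℕ} (hn : 1 ≤ n) (hM : 3 ≤ M) (K : Fin (d + 1) → ℕ) (C : Finset (Fin (d + 1) → ℤ))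
    {a : ℝ} (ha : 0 < a) (hsmall : (3 : ℝ) ^ (d + 1) * tau d M a < 1) (x y : ↥(reg (M * n) K C)) {N : ℕ} (hN : 1 ≤ N)
    (hfar : ∃ μ, (((2 * N + 3) * (M * n) + n : ℕ) : ℤ) ≤ |x.1 μ - y.1 μ|) :
    |(fineOpR n a 0 (reg (M * n) K C))⁻¹ x y| ≤
      (3 : ℝ) ^ (d + 1) * (1 / min (min 2 a) 1) * tau d M a * (3 : ℝ) ^ (d + 1) *
        ((3 : ℝ) ^ (d + 1) * tau d M a) ^ (N - 1) / (1 - (3 : ℝ) ^ (d + 1) * tau d M a) := by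
  classical
  obtain ⟨hW, hW2, hρ⟩ := scale_facts hn hM
  have hσ : 0 < min 2 a := lt_min two_pos ha
  have hα : 0 ≤ alpha2 d M := by unfold alpha2; positivity
  have hβ : 0 ≤ beta2 d M a := by unfold beta2; positivity
  obtain ⟨μ, hμ⟩ := hfar
  have h := inv_entry_decay (labPos K) (labPos_injective K) (fineOpR n a 0 (reg (M * n) K C)) hσ
    (fineOpR_coercive_region hn ha M K C)
    (cutG n M K C) (indG n M K C) (regG n M K C) (fun J J' hJJ' => disjoint_regG K C hρ hJJ') (cutoffOn_cutG hn K C hW)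
    (sum_cutG_mul_indG K C hW)
    zero_le_one (fun J x => (cutG_indG_bounds K C J x).1) (fun J x => (cutG_indG_bounds K C J x).2.2)
    (fun J x => (cutG_indG_bounds K C J x).2.1) hα hβ (hcomm_cutG hn K C ha hW2) (by rw [tau] at hsmall; exact hsmall)
    ((l2_opNorm_remainder_region hn hM K C ha).trans_lt hsmall) x y (count_cover_le_region K C hρ x).2 hN
    (fun J hJ J' hJ' => ⟨μ, label_sep_of_far hW hJ (((cutG_indG_bounds K C J' y).2.2) hJ') (by exact_mod_cast hμ)⟩)
  rw [tau]
  refine h.trans (le_of_eq ?_)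
  push_cast
  ring

/-! ### §4 The same for an arbitrary union of big blocks `R` (transport along `reg (Mn) K (R.image (blk (Mn))) = R`) -/

/-- entries of the inverse do not see which (equal) finite set indexes the matrix. [folklore] -/
theorem inv_fineOpR_transport {n : ℕ} {a : ℝ} {R₁ R₂ : Finset (Fin (d + 1) → ℤ)} (h : R₁ = R₂) (x y : ↥R₂) :
    (fineOpR n a 0 R₁)⁻¹ ⟨x.1, h ▸ x.2⟩ ⟨y.1, h ▸ y.2⟩ = (fineOpR n a 0 R₂)⁻¹ x y := by
  subst h; rfl

/-- **B4 (2.22)∕(2.30) AT `A = 0` FOR `G_k(Ω,0)`, `Ω` ANY UNION OF BIG BLOCKS**: for `R ⊆ Π_μ[0,(2K_μ+1)Mn)` a union of `Mn`-blocks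
(`IsBlockUnion (Mn) R` — B4's «Ω a union of big blocks (cubes of size M)», mesh `1∕n`), `3^{d+1}τ < 1`, and sites `x, y ∈ R` with
`|x_μ − y_μ| ≥ (2N+3)Mn + n` in some coordinate (`N ≥ 1`):
`|(fineOpR n a 0 R)⁻¹(x,y)| ≤ 3^{d+1}·(min(min(2,a),1))⁻¹·τ·3^{d+1}·(3^{d+1}τ)^{N−1}∕(1 − 3^{d+1}τ)` — the region theorem transported along
`NE7K1LinWalkRegion.reg_image_blk_eq`. [cite: Balaban1983RegularityDecay, (2.22) p.579, Corollary 2.3 (2.30) pp.580–581, case A = 0] [folklore] -/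
theorem fineOpR_inv_entry_decay_blockUnion {n M : ℕ} (hn : 1 ≤ n) (hM : 3 ≤ M) (K : Fin (d + 1) → ℕ)
    {R : Finset (Fin (d + 1) → ℤ)} (hR : IsBlockUnion (M * n) R) (hRbox : R ⊆ boxDom (fun μ => (2 * K μ + 1) * (M * n)))
    {a : ℝ} (ha : 0 < a) (hsmall : (3 : ℝ) ^ (d + 1) * tau d M a < 1) (x y : ↥R) {N : ℕ} (hN : 1 ≤ N)
    (hfar : ∃ μ, (((2 * N + 3) * (M * n) + n : ℕ) : ℤ) ≤ |x.1 μ - y.1 μ|) :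
    |(fineOpR n a 0 R)⁻¹ x y| ≤
      (3 : ℝ) ^ (d + 1) * (1 / min (min 2 a) 1) * tau d M a * (3 : ℝ) ^ (d + 1) *
        ((3 : ℝ) ^ (d + 1) * tau d M a) ^ (N - 1) / (1 - (3 : ℝ) ^ (d + 1) * tau d M a) := by
  have e : reg (M * n) K (R.image (blk (M * n))) = R := reg_image_blk_eq hR hRbox
  rw [← inv_fineOpR_transport e x y]
  exact fineOpR_inv_entry_decay_region hn hM K (R.image (blk (M * n))) ha hsmall _ _ hN hfar

end Summit.QuantumFields.BalabanUV.T4Continuum.NE7K1LinWalkFineOpRegion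

end
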